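import Summits.ABC.StewartYu.PadicG3ParVA
import Summits.ABC.StewartYu.PadicG3ParGB
import HarnessLib

/-!
# The `p`-adic Gen-3 parameter record v2 (corrected family `…V`) — part VB: floors of the corrected family

Support file (plain theorems; no named facts). Continues `PadicG3ParVA`; the `g`-level facts
(`yloadG_le_eleven_G`, `pow_g_le`, `lgg_log_two_le`) are those of `PadicG3ParGB` (unchanged). Twins of GB's floors:
`W + log(2 LV) + 1 ≤ W_LV`, `(n+1)·LV·W_LV ≤ G·XV·LV/64`, `HV ≤ G XV/(64(n+1))`, `XV ≤ 9 HV`,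
`L₀V ≤ G·g·XV·LgV/(4·yloadG) + 1`, `MordV 0 0 ≤ (448/27)(n+1)LgV + (n+1)(ŜG+1) ≤ 17(n+1)LgV − n`.

## References
* [Nesterenko2003] Yu. V. Nesterenko, LNM 1819 (2003) — §3.5.
-/

noncomputable section

open Finset Real

namespace Summit.ABC.StewartYu

namespace PadicG3Par

variable {n : ℕ} (P : PadicG3Par n)

/-! ### Floors of the v2 family -/

/-- `1 ≤ XV` (real). [folklore] -/
theorem one_le_XV : (1 : ℝ) ≤ P.XV := by linarith [P.XV_ge_128]

/-- `W_LG = 1 + log(1 + 2 e^W LV)`. [folklore] -/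
theorem WLV_eq : P.WLV = 1 + Real.log (1 + 2 * Real.exp P.W * P.LV) := by
  unfold WLV
  rw [Real.log_mul (Real.exp_pos 1).ne' (by positivity), Real.log_exp]

/-- **`W + log(2 LV) + 1 ≤ W_LG`**. [folklore] -/
theorem W_add_log_le_WLV : P.W + Real.log (2 * P.LV) + 1 ≤ P.WLV := by
  rw [P.WLV_eq]
  have hL : (0 : ℝ) < P.LV := by linarith [P.one_le_LV]
  have h1 : Real.log (2 * Real.exp P.W * P.LV) ≤ Real.log (1 + 2 * Real.exp P.W * P.LV) :=
    Real.log_le_log (by positivity) (by linarith)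
  have h2 : Real.log (2 * Real.exp P.W * P.LV) = P.W + Real.log (2 * P.LV) := by
    rw [show 2 * Real.exp P.W * P.LV = Real.exp P.W * (2 * P.LV) by ring,
      Real.log_mul (Real.exp_pos _).ne' (by positivity), Real.log_exp]
  linarith

/-- `log LV ≤ W_LG`. [folklore] -/
theorem log_LV_le_WLV : Real.log P.LV ≤ P.WLV := by
  have h := P.W_add_log_le_WLV
  have hL : (0 : ℝ) < P.LV := by linarith [P.one_le_LV]
  have h1 : Real.log P.LV ≤ Real.log (2 * P.LV) := Real.log_le_log hL (by linarith)
  linarith [P.hW]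

/-- `1 ≤ W_LG`. [folklore] -/
theorem WLV_ge_one : 1 ≤ P.WLV := by
  have h := P.W_add_log_le_WLV
  have : 0 ≤ Real.log (2 * (P.LV : ℝ)) := Real.log_nonneg (by linarith [P.one_le_LV])
  linarith [P.hW]

/-- **`(n+1)·LV·W_LG ≤ G·XV·LV/64`** (the directional share, first branch of `XV`). [folklore] -/
theorem WLV_mul_le : (n + 1) * P.LV * P.WLV ≤ P.G * P.XV * P.LV / 64 := by
  have h := P.mainV_le_XV
  have hG : 0 < P.G := by linarith [P.eight_le_G]
  have hL : (0 : ℝ) ≤ P.LV := by positivity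
  rw [div_le_iff₀ hG] at h
  rw [le_div_iff₀ (by norm_num)]
  nlinarith

/-- `64 (n+1) ≤ G XV`. [folklore] -/
theorem GXV_ge : (64 : ℝ) * (n + 1) ≤ P.G * P.XV := by
  have h1 := P.eight_le_G
  have h2 := P.sixtyfour_le_XV'
  have h0 : (0 : ℝ) ≤ n := by positivity
  nlinarith

/-- **`HV ≤ G XV/(64 (n+1))`**. [cite: Nesterenko2003, (3.23)] -/
theorem HV_le : (P.HV : ℝ) ≤ P.G * P.XV / (64 * (n + 1)) := by
  have hy : (1 : ℝ) ≤ P.G * P.XV / (64 * (n + 1)) := by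
    rw [le_div_iff₀ (by positivity)]; linarith [P.GXV_ge]
  unfold HV
  rw [Nat.cast_max, Nat.cast_one]
  exact max_le hy (Nat.floor_le (by linarith))

/-- `G XV/(64 (n+1)) − 1 < HV`. [folklore] -/
theorem HV_gt : P.G * P.XV / (64 * (n + 1)) - 1 < P.HV := by
  have h1 := Nat.lt_floor_add_one (P.G * P.XV / (64 * (n + 1)))
  have h2 : (⌊P.G * P.XV / (64 * (n + 1))⌋₊ : ℝ) ≤ P.HV := by
    unfold HV; exact_mod_cast le_max_right _ _
  linarith

/-- **`XV ≤ 9 HV`** (`G ≥ 8(n+1)`, `XV ≥ 72`). [folklore] -/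
theorem XV_le_nine_HV : (P.XV : ℝ) ≤ 9 * P.HV := by
  have h1 := P.HV_gt
  have hG := P.cG_mul_le_G
  unfold cG at hG
  have hX := P.XV_ge_128
  have h2 : (P.XV : ℝ) / 8 ≤ P.G * P.XV / (64 * (n + 1)) := by
    rw [div_le_div_iff₀ (by norm_num) (by positivity)]
    have h0 : (0 : ℝ) ≤ P.XV := by linarith
    nlinarith
  linarith

/-- `C_bⁿ Ω K/gⁿ ≤ LgV G/(24 yloadG)`. [folklore] -/
theorem coreV_le : Cb ^ n * P.Ω * P.K / P.g ^ n ≤ P.LgV * P.G / (24 * P.yloadG) := by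
  have h := P.mainV_le_LgV
  have hG : 0 < P.G := by linarith [P.eight_le_G]
  have hY := P.yloadG_pos
  have hg : 0 < P.g ^ n := pow_pos (lt_of_lt_of_le one_pos P.one_le_g) n
  rw [le_div_iff₀ (by positivity)]
  rw [div_le_iff₀ (by positivity)] at h
  have e : Cb ^ n * P.Ω * P.K / P.g ^ n * (24 * P.yloadG) =
      24 * Cb ^ n * P.Ω * P.K * P.yloadG / P.g ^ n := by field_simp
  rw [e, div_le_iff₀ hg]
  linarith

/-- **`L₀V ≤ G g XV LgV/(4·yloadG) + 1`**. [folklore] -/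
theorem L0V_le : (P.L0V : ℝ) ≤ P.G * (P.g * P.XV * P.LgV) / (4 * P.yloadG) + 1 := by
  have h1 := P.L0V_lt
  have h2 := P.coreV_le
  have hY := P.yloadG_pos
  have hX : (0 : ℝ) ≤ P.XV := by positivity
  have hg0 : 0 < P.g := lt_of_lt_of_le one_pos P.one_le_g
  have hg : 0 < P.g ^ n := pow_pos hg0 n
  have hgn : 0 < P.g ^ (n - 1) := pow_pos hg0 _
  have e : 6 * (P.XV : ℝ) * Cb ^ n * P.Ω * P.K / P.g ^ (n - 1) =
      6 * P.g * P.XV * (Cb ^ n * P.Ω * P.K / P.g ^ n) := by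
    rw [P.pow_g_eq]; field_simp
  have h3 : 6 * (P.XV : ℝ) * Cb ^ n * P.Ω * P.K / P.g ^ (n - 1) ≤ P.G * (P.g * P.XV * P.LgV) / (4 * P.yloadG) := by
    rw [e]
    have hgX : 0 ≤ 6 * P.g * P.XV := by positivity
    have := mul_le_mul_of_nonneg_left h2 hgX
    have e2 : 6 * P.g * P.XV * (P.LgV * P.G / (24 * P.yloadG)) = P.G * (P.g * P.XV * P.LgV) / (4 * P.yloadG) := by
      field_simp; ring
    linarith [e2.le, e2.ge]
  linarith

/-- `L₀V · yloadG ≤ G g XV LgV/4 + yloadG`. [folklore] -/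
theorem L0V_mul_yloadG_le : P.L0V * P.yloadG ≤ P.G * (P.g * P.XV * P.LgV) / 4 + P.yloadG := by
  have h := P.L0V_le
  have hY := P.yloadG_pos
  have := mul_le_mul_of_nonneg_right h hY.le
  have e : (P.G * (P.g * P.XV * P.LgV) / (4 * P.yloadG) + 1) * P.yloadG = P.G * (P.g * P.XV * P.LgV) / 4 + P.yloadG := by
    field_simp
  linarith

/-- `MV = 16 (n+1) LgV` (real). [folklore] -/
theorem MV_real : (P.MV : ℝ) = 16 * (n + 1) * P.LgV := by rw [P.MV_eq]; push_cast; ring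

/-- **`MordV 0 0 ≤ (16 + 16/27)(n+1) LgV + (n+1)(ŜG+1)`**. [cite: Nesterenko2003, (3.25)] -/
theorem MordV_zero_zero_real_le :
    (P.MordV 0 0 : ℝ) ≤ (448 / 27) * (n + 1) * P.LgV + (n + 1) * (P.SdG + 1) := by
  have h := P.MordV_zero_zero_le
  have h1 : ((P.MordV 0 0 : ℕ) : ℝ) ≤ ((P.MV / (n + 2) ^ 3 + (n + 1) * (16 * P.LgV + (P.SdG + 1)) : ℕ) : ℝ) := by
    exact_mod_cast h
  have h2 : ((P.MV / (n + 2) ^ 3 : ℕ) : ℝ) ≤ (P.MV : ℝ) / 27 := by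
    have h3 : P.MV / (n + 2) ^ 3 ≤ P.MV / 27 :=
      Nat.div_le_div_left (le_trans (by norm_num) (Nat.pow_le_pow_left (show 3 ≤ n + 2 by have := P.hn; omega) 3))
        (by norm_num)
    calc ((P.MV / (n + 2) ^ 3 : ℕ) : ℝ) ≤ ((P.MV / 27 : ℕ) : ℝ) := by exact_mod_cast h3
      _ ≤ (P.MV : ℝ) / 27 := Nat.cast_div_le
  push_cast at h1
  rw [P.MV_real] at h2
  linarith

/-- **`MordV 0 0 + n ≤ 17 (n+1) LgV`** (as `4(ŜG+2) ≤ LgV`). [folklore] -/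
theorem MordV_zero_zero_add_le : (P.MordV 0 0 : ℝ) + n ≤ 17 * (n + 1) * P.LgV := by
  have h := P.MordV_zero_zero_real_le
  have h4 : ((4 * (P.SdG + 2) : ℕ) : ℝ) ≤ P.LgV := by exact_mod_cast P.four_SdG_le_LgV
  push_cast at h4
  have hn : (0 : ℝ) ≤ n := by positivity
  nlinarith

end PadicG3Par

end Summit.ABC.StewartYu
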